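import Literature.NumberTheory.LFunctions.ExceptionalCharacters
import HarnessLib

/-!
# Twin primes via exceptional characters: the Hardy–Littlewood pair asymptotic with an error
# governed by `L(1, χ)` (Friedlander–Iwaniec 2019, Theorem 1 and Corollary 1.1 [Heath-Brown])

Topic `Literature/NumberTheory/LFunctions` (namespace `Literature.NumberTheory.LFunctions`).
STATEMENT LAYER for the cell `parity-realchar` (SIEGEL INSTRUMENT, deliverable "illusory-world
conditionals"): ONE named fact (D-0014) — Friedlander–Iwaniec's Theorem 1, a published theorem we
have not proved, stated as a closed `Prop` — and everything else PROVED from it: Corollary 1.1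
("If there are infinitely many exceptional characters then there are infinitely many twin prime
numbers", the result of Heath-Brown 1983) in two quantitative readings of "exceptional".

This complements, and does not restate, the tree's record of Heath-Brown's dichotomy
`Literature.Barriers.Parity.SiegelZeroTwinPrimes : UnboundedSiegelZeros → TwinPrimeConjecture`
(`Barriers/Parity/SiegelZeroDichotomy.lean`; antecedent = Siegel zeros of unbounded QUALITY in the
sense of Tao–Teräväinen, Definition 1.4; proved modulo Matomäki–Merikoski, Corollary 1.1(i)). The
present antecedent is Friedlander–Iwaniec's: `η(D) = L(1,χ) log D` small for real primitive
characters of arbitrarily large conductor. The two antecedents are not compared here (a zero of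
quality `η_TT` gives only `η(D) ≪ log² D / η_TT` by the bound `L(1,χ) ≪ (1 − β) log² D`, and
`η(D) → 0` gives a zero with `(1 − β) log D ≪ η(D)` only through Hecke's converse in the range
`L(1,χ) < A₀/log²(4D)`), so neither record implies the other formally; Heath-Brown's own
hypothesis (PLMS 47 (1983), Theorem 1) is not transcribed because that text is not held
(acquisition request acq-00505, cite-only) — Corollary 1.1 below is Friedlander–Iwaniec's printed
attribution "the following result of Heath-Brown [H-B]".

## What the source prints (held text `paper:arxiv-1607.03261`, read 2026-08-25)

J. B. Friedlander, H. Iwaniec, *Twin primes via exceptional characters*, Banach Center Publ. 118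
(2019) 85–94 = arXiv:1607.03261, §1:
"given a positive even number `h`, we expect the asymptotic formula
`S_h(x) = ∑_{n ≤ x} Λ(n)Λ(n+h) ∼ B C(h) x` (1.1) to hold as `x → ∞`, where `B` is the absolute
constant `B = 2∏_{p>2}(1 − 1/(p−1))(1 − 1/p)^{−1}` (1.2) and … `C(h) = ∏_{p ∣ h, p > 2}(1 − 1/(p−1))^{−1}`
(1.3). … with a primitive, real character `χ (mod D)`.
**THEOREM 1.** Let `x ≥ D^{3500}`. For any even positive number `h` we have
`S_h(x) = B C(h) x + O(L(1,χ) x log x + x/log x)` (1.5) where the implied constant depends only on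
`h`. The result is unconditional but is meaningful only if `L(1,χ)` is sufficiently small. We put
`η(D) = L(1,χ) log D` (1.6). If `η(D)` is small we call the character `χ` exceptional. For such
characters the error term in (1.5), say `xE(x)`, is also relatively small, namely
`E(x) ≪ η(D)A + 1/log D`, if `D^{3500} ≤ x ≤ D^A` (1.7). Hence, we conclude the following result of
Heath-Brown [H-B]. **COROLLARY 1.1.** If there are infinitely many exceptional characters then
there are infinitely many twin prime numbers."

## Lean rendering / design choices

* `B C(h)`, `h` even, is the tree's `Literature.NumberTheory.Sieve.goldbachSingularSeries h =
  2C₂ ∏_{p ∣ h, p>2} (p−1)/(p−2)` (`goldbachSingularSeries_of_even`;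
  `(1 − 1/(p−1))(1 − 1/p)^{−1} = 1 − 1/(p−1)²` and `(1 − 1/(p−1))^{−1} = (p−1)/(p−2)`), exactly the
  `𝔖_h` of the tree's Matomäki–Merikoski facts; `S_h(x) = ∑_{n ∈ [1, ⌊x⌋]} Λ(n)Λ(n+h)` as there.
* "a primitive, real character `χ (mod D)`": `χ.IsPrimitive`, `χ.IsQuadratic`, `3 ≤ D` (the
  conductor of a real primitive character; this only removes the trivial character and keeps
  `log x ≥ 3500 log 3 > 0`). `L(1,χ)` (real, positive) is `‖χ.LFunction 1‖` as in
  `ExceptionalCharactersOfStrength`.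
* "the implied constant depends only on `h`": `∀ h, ∃ K > 0, ∀ D χ x …`.
* Corollary 1.1's hypothesis "infinitely many exceptional characters", with "exceptional" =
  "`η(D)` small" as printed in (1.6), is rendered at face value as `∀ ε > 0, SmallEtaCharacters ε`,
  where the parametrised PREDICATE `SmallEtaCharacters ε` says: there are primitive real characters
  of arbitrarily large conductor with `η(D) ≤ ε` (a hypothesis to argue under, never asserted — the
  design of the tree's `ExceptionalCharactersOfStrength A`). The Merikoski-style strengths feed it:
  `ExceptionalCharactersOfStrength A → SmallEtaCharacters ε` for every `A > 1`, `ε > 0` (proved).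

PROVED here: `twinPrimeConjecture_of_smallEtaCharacters` (Theorem 1 ⟹ Corollary 1.1, by the tree's
`Literature.Barriers.Parity.robustHLFailure_of_not_twinPrime`: without twin primes above `n₀` the
pair sum is `o(X)`, against `S_2(X) ≥ 2C₂X − K(3500 η(D) + 1/(3500 log D))X` at `X = D^{3500}`),
`FriedlanderIwaniec2019_corollary11` (the printed corollary, as a theorem with Theorem 1 as its
named-fact hypothesis), and the strength-`A` form
`twinPrimeConjecture_of_exceptionalCharactersOfStrength` (`A > 1`).

## References

* [FriedlanderIwaniec2019TwinPrimes] J. B. Friedlander, H. Iwaniec, *Twin primes via exceptional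
  characters*, Banach Center Publ. 118 (2019), arXiv:1607.03261, Theorem 1, (1.6)–(1.7),
  Corollary 1.1.
* [Heathbrown1983] D. R. Heath-Brown, *Prime twins and Siegel zeros*, PLMS (3) 47 (1983) 193–224
  (the attribution of Corollary 1.1; text not held).
-/

noncomputable section

open Filter Finset
open scoped ArithmeticFunction.vonMangoldt

namespace Literature.NumberTheory.LFunctions

open Literature.NumberTheory.Sieve Literature.Barriers.Parity

/-! ### The named fact -/

/-- **Friedlander–Iwaniec 2019, Theorem 1.** "Let `x ≥ D^{3500}`. For any even positive number `h`
we have `S_h(x) = B C(h) x + O(L(1,χ) x log x + x/log x)` where the implied constant depends only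
on `h`"; `S_h(x) = ∑_{n ≤ x} Λ(n)Λ(n+h)`, `χ (mod D)` a primitive real character, `B C(h) = 𝔖_h`
(`goldbachSingularSeries h`). Rendered: for every even `h ≥ 1` there is `K > 0` such that for every
`D ≥ 3`, every primitive quadratic `χ` mod `D` and every real `x ≥ D^{3500}`,
`|S_h(x) − x 𝔖_h| ≤ K (L(1,χ) x log x + x/log x)`. "The result is unconditional but is meaningful
only if `L(1,χ)` is sufficiently small." NAMED FACT, not proved here.
[cite: FriedlanderIwaniec2019TwinPrimes, Theorem 1] -/
def FriedlanderIwaniec2019_theorem1 : Prop :=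
  ∀ h : ℕ, 1 ≤ h → Even h → ∃ K : ℝ, 0 < K ∧
    ∀ (D : ℕ) [NeZero D], 3 ≤ D → ∀ χ : DirichletCharacter ℂ D, χ.IsPrimitive → χ.IsQuadratic →
      ∀ x : ℝ, (D : ℝ) ^ (3500 : ℕ) ≤ x →
        |(∑ n ∈ Icc 1 ⌊x⌋₊, Λ n * Λ (n + h)) - x * goldbachSingularSeries h| ≤
          K * (‖χ.LFunction 1‖ * x * Real.log x + x / Real.log x)

/-! ### The hypothesis of Corollary 1.1 -/

/-- **Exceptional characters with `η(D) ≤ ε` at arbitrarily large conductors** (Friedlander–Iwaniec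
(1.6): "We put `η(D) = L(1,χ) log D`. If `η(D)` is small we call the character `χ` exceptional"):
for every `q₀` there is a primitive quadratic character `χ` of some conductor `D ≥ q₀`, `D ≥ 3`,
with `η(D) = ‖L(1,χ)‖ log D ≤ ε`. Corollary 1.1's hypothesis "infinitely many exceptional
characters" is `∀ ε > 0, SmallEtaCharacters ε`. A parametrised PREDICATE naming a hypothesis to
argue under (for small `ε` expected false: under the tree's `NoSiegelZeros`, `L(1,χ) ≫ 1/log D`);
no instance is asserted anywhere — the same design as `ExceptionalCharactersOfStrength`.
[cite: FriedlanderIwaniec2019TwinPrimes, (1.6) and Corollary 1.1 (hypothesis)] -/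
def SmallEtaCharacters (ε : ℝ) : Prop :=
  ∀ q₀ : ℕ, ∃ (D : ℕ) (_ : NeZero D) (χ : DirichletCharacter ℂ D),
    q₀ ≤ D ∧ 3 ≤ D ∧ χ.IsPrimitive ∧ χ.IsQuadratic ∧ ‖χ.LFunction 1‖ * Real.log D ≤ ε

/-- Monotonicity: `η(D) ≤ ε` at arbitrarily large conductors implies the same for any `ε' ≥ ε`.
[cite: FriedlanderIwaniec2019TwinPrimes, (1.6)] -/
theorem SmallEtaCharacters.mono {ε ε' : ℝ} (hle : ε ≤ ε') (h : SmallEtaCharacters ε) :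
    SmallEtaCharacters ε' := by
  intro q₀
  obtain ⟨D, hDne, χ, hq₀, hD3, hprim, hquad, hη⟩ := h q₀
  exact ⟨D, hDne, χ, hq₀, hD3, hprim, hquad, hη.trans hle⟩

/-! ### Proofs -/

/-- For `D ≥ 3`, `1 ≤ log D` (indeed `log 3 > 1`). [folklore] -/
private theorem one_le_log_of_three_le {D : ℕ} (hD : 3 ≤ D) : 1 ≤ Real.log D := by
  have hD3 : (3 : ℝ) ≤ D := by exact_mod_cast hD
  rw [← Real.log_exp 1]
  refine Real.log_le_log (Real.exp_pos 1) (le_trans ?_ hD3)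
  have := Real.exp_one_lt_d9
  linarith

/-- Strength `A > 1` in Merikoski's sense (`‖L(1,χ)‖ ≤ (log q)^{−A}` at arbitrarily large
conductors, `ExceptionalCharactersOfStrength A`) gives `η(D) ≤ (log D)^{1−A} → 0`, hence
`SmallEtaCharacters`. [cite: FriedlanderIwaniec2019TwinPrimes, (1.6)] -/
theorem smallEtaCharacters_of_exceptionalCharactersOfStrength {A : ℝ} (hA : 1 < A)
    (h : ExceptionalCharactersOfStrength A) {ε : ℝ} (hε : 0 < ε) : SmallEtaCharacters ε := by
  intro q₀
  -- threshold `T` with `T^{1-A} ≤ ε`, i.e. `T ≥ ε^{-1/(A-1)}`; take conductors with `log D ≥ T`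
  set T : ℝ := max 1 ((1 / ε) ^ (1 / (A - 1))) with hT
  have hT1 : 1 ≤ T := le_max_left _ _
  obtain ⟨D, hDne, χ, hD, hprim, hne, hquad, hL⟩ := h (max q₀ (max 3 (⌈Real.exp T⌉₊)))
  have hq₀ : q₀ ≤ D := le_trans (le_max_left _ _) hD
  have hD3 : 3 ≤ D := le_trans (le_trans (le_max_left _ _) (le_max_right _ _)) hD
  have hDexp : ⌈Real.exp T⌉₊ ≤ D := le_trans (le_trans (le_max_right _ _) (le_max_right _ _)) hD
  have hlog1 : 1 ≤ Real.log D := one_le_log_of_three_le hD3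
  have hlogpos : 0 < Real.log D := by linarith
  have hlogT : T ≤ Real.log D := by
    have h1 : Real.exp T ≤ D := le_trans (Nat.le_ceil _) (by exact_mod_cast hDexp)
    calc T = Real.log (Real.exp T) := (Real.log_exp T).symm
      _ ≤ Real.log D := Real.log_le_log (Real.exp_pos T) h1
  refine ⟨D, hDne, χ, hq₀, hD3, hprim, hquad, ?_⟩
  -- `‖L(1,χ)‖ log D ≤ (log D)^{-A} log D = (log D)^{1-A} ≤ T^{1-A} ≤ ε`
  have h1 : ‖χ.LFunction 1‖ * Real.log D ≤ Real.log D ^ (1 - A) := by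
    have := mul_le_mul_of_nonneg_right hL hlogpos.le
    have hrw : Real.log D ^ (-A) * Real.log D = Real.log D ^ (1 - A) := by
      rw [show (1 : ℝ) - A = -A + 1 by ring, Real.rpow_add_one hlogpos.ne']
    linarith [hrw]
  have h2 : Real.log D ^ (1 - A) ≤ T ^ (1 - A) := by
    have hneg : 1 - A ≤ 0 := by linarith
    exact Real.rpow_le_rpow_of_nonpos (by linarith) hlogT hneg
  have h3 : T ^ (1 - A) ≤ ε := by
    have hA1 : 0 < A - 1 := by linarith
    have hTε : (1 / ε) ^ (1 / (A - 1)) ≤ T := le_max_right _ _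
    have hεpos' : 0 < (1 / ε) ^ (1 / (A - 1)) := Real.rpow_pos_of_pos (by positivity) _
    -- `T^{1-A} ≤ ((1/ε)^{1/(A-1)})^{1-A} = (1/ε)^{-1} = ε`
    calc T ^ (1 - A) ≤ ((1 / ε) ^ (1 / (A - 1))) ^ (1 - A) :=
          Real.rpow_le_rpow_of_nonpos hεpos' hTε (by linarith)
      _ = (1 / ε) ^ ((1 / (A - 1)) * (1 - A)) := by
          rw [← Real.rpow_mul (by positivity)]
      _ = (1 / ε) ^ (-1 : ℝ) := by
          congr 1
          field_simp
          ring
      _ = ε := by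
          rw [Real.rpow_neg_one]
          simp
  linarith

/-- **Theorem 1 ⟹ twin primes under `SmallEtaCharacters`** (Corollary 1.1 made quantitative). If
twin primes were finite, the pair sum `S_2(X)` would be `o(X)`
(`Literature.Barriers.Parity.robustHLFailure_of_not_twinPrime`: eventually
`C₂ X ≤ |S_2(X) − 2C₂X|`); but at `X = D^{3500}` Theorem 1 with `η(D) ≤ ε` gives
`|S_2(X) − 2C₂X| ≤ K(3500 η(D) + 1/(3500 log D))X < C₂X` once `ε ≤ C₂/(4·3500 K)` and
`log D ≥ 4K/(3500 C₂)`. [cite: FriedlanderIwaniec2019TwinPrimes, Theorem 1, (1.7) and Corollary 1.1] -/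
theorem twinPrimeConjecture_of_smallEtaCharacters (hFI : FriedlanderIwaniec2019_theorem1)
    (hexc : ∀ ε : ℝ, 0 < ε → SmallEtaCharacters ε) : TwinPrimeConjecture := by
  by_contra hno
  obtain ⟨K, hK, hT⟩ := hFI 2 (by norm_num) (by decide)
  have hC₂ : 0 < twinPrimeConst := twinPrimeConst_pos_holds
  obtain ⟨X₁, hX₁⟩ := eventually_atTop.mp (robustHLFailure_of_not_twinPrime hno)
  -- parameters
  set ε : ℝ := twinPrimeConst / (4 * 3500 * K) with hε
  have hεpos : 0 < ε := by positivity
  set L : ℝ := 4 * K / (3500 * twinPrimeConst) with hL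
  have hLpos : 0 < L := by positivity
  obtain ⟨D, hDne, χ, hDq, hD3, hprim, hquad, hη⟩ :=
    hexc ε hεpos (max (⌈X₁⌉₊) (⌈Real.exp L⌉₊))
  have hDX₁ : ⌈X₁⌉₊ ≤ D := le_trans (le_max_left _ _) hDq
  have hDL : ⌈Real.exp L⌉₊ ≤ D := le_trans (le_max_right _ _) hDq
  have hD3r : (3 : ℝ) ≤ D := by exact_mod_cast hD3
  have hDpos : (0 : ℝ) < D := by linarith
  have hD1 : (1 : ℝ) ≤ D := by linarith
  have hlog1 : 1 ≤ Real.log D := one_le_log_of_three_le hD3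
  have hlogpos : 0 < Real.log D := by linarith
  have hlogL : L ≤ Real.log D := by
    have h1 : Real.exp L ≤ D := le_trans (Nat.le_ceil _) (by exact_mod_cast hDL)
    calc L = Real.log (Real.exp L) := (Real.log_exp L).symm
      _ ≤ Real.log D := Real.log_le_log (Real.exp_pos L) h1
  -- the scale `X = D^{3500}`
  set X : ℝ := (D : ℝ) ^ (3500 : ℕ) with hX
  have hXpos : 0 < X := by positivity
  have hXD : (D : ℝ) ≤ X := by
    calc (D : ℝ) = (D : ℝ) ^ 1 := (pow_one _).symm
      _ ≤ X := pow_le_pow_right₀ hD1 (by norm_num)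
  have hX₁X : X₁ ≤ X := le_trans (le_trans (Nat.le_ceil X₁) (by exact_mod_cast hDX₁)) hXD
  have hlogX : Real.log X = 3500 * Real.log D := by
    rw [hX, Real.log_pow]; norm_num
  -- Theorem 1 at `X`
  have h1 := hT D hD3 χ hprim hquad X le_rfl
  -- the failure at `X`
  have h2 := hX₁ X hX₁X
  -- the error is `< C₂ X`
  have herr : K * (‖χ.LFunction 1‖ * X * Real.log X + X / Real.log X) < twinPrimeConst * X := by
    rw [hlogX]
    have ha : K * (‖χ.LFunction 1‖ * X * (3500 * Real.log D)) ≤ twinPrimeConst / 4 * X := by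
      have : K * (‖χ.LFunction 1‖ * X * (3500 * Real.log D)) =
          (3500 * K) * (‖χ.LFunction 1‖ * Real.log D) * X := by ring
      rw [this]
      have hb : (3500 * K) * (‖χ.LFunction 1‖ * Real.log D) ≤ (3500 * K) * ε :=
        mul_le_mul_of_nonneg_left hη (by positivity)
      have hc : (3500 * K) * ε = twinPrimeConst / 4 := by
        rw [hε]; field_simp
      nlinarith
    have hb : K * (X / (3500 * Real.log D)) ≤ twinPrimeConst / 4 * X := by
      have h3 : K / (3500 * Real.log D) ≤ twinPrimeConst / 4 := by
        rw [div_le_div_iff₀ (by positivity) (by norm_num)]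
        have : 4 * K ≤ L * (3500 * twinPrimeConst) := by
          rw [hL]; field_simp; exact le_rfl
        nlinarith
      have : K * (X / (3500 * Real.log D)) = K / (3500 * Real.log D) * X := by ring
      rw [this]
      exact mul_le_mul_of_nonneg_right h3 hXpos.le
    have hsplit : K * (‖χ.LFunction 1‖ * X * (3500 * Real.log D) + X / (3500 * Real.log D)) =
        K * (‖χ.LFunction 1‖ * X * (3500 * Real.log D)) + K * (X / (3500 * Real.log D)) := by
      ring
    rw [hsplit]
    nlinarith
  linarith

/-- **Friedlander–Iwaniec 2019, Corollary 1.1** ("the following result of Heath-Brown [H-B]"):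
"If there are infinitely many exceptional characters then there are infinitely many twin prime
numbers" — PROVED from the named fact Theorem 1, with "infinitely many exceptional characters"
read as `∀ ε > 0, SmallEtaCharacters ε` ((1.6): `η(D) = L(1,χ) log D` small at arbitrarily large
conductors). [cite: FriedlanderIwaniec2019TwinPrimes, Corollary 1.1] -/
theorem FriedlanderIwaniec2019_corollary11 (hFI : FriedlanderIwaniec2019_theorem1)
    (hexc : ∀ ε : ℝ, 0 < ε → SmallEtaCharacters ε) : TwinPrimeConjecture :=
  twinPrimeConjecture_of_smallEtaCharacters hFI hexc

/-- **Strength form**: Theorem 1 and exceptional characters of any strength `A > 1`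
(`‖L(1,χ)‖ ≤ (log q)^{−A}` at arbitrarily large conductors) give the twin prime conjecture. (For
`A ≥ 3` the tree already routes this through Siegel zeros of unbounded quality and
Matomäki–Merikoski: `unboundedSiegelZeros_of_exceptionalCharactersOfStrength`,
`Literature.Barriers.Parity.SiegelZeroTwinPrimes_of_matomakiMerikoski`; the present route needs
only `A > 1`.) [cite: FriedlanderIwaniec2019TwinPrimes, Theorem 1 and Corollary 1.1] -/
theorem twinPrimeConjecture_of_exceptionalCharactersOfStrength (hFI : FriedlanderIwaniec2019_theorem1)
    {A : ℝ} (hA : 1 < A) (h : ExceptionalCharactersOfStrength A) : TwinPrimeConjecture :=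
  twinPrimeConjecture_of_smallEtaCharacters hFI
    (fun _ hε => smallEtaCharacters_of_exceptionalCharactersOfStrength hA h hε)

/-- **The no-go reading** (cf. `Literature.Barriers.Parity.SiegelZeroTwinPrimes.disproof_bounds_quality`):
modulo Theorem 1, a DISPROOF of the twin prime conjecture is a proof that `η(D) = L(1,χ) log D` is
bounded below at large conductors — there are `ε > 0` and `q₀` with `‖L(1,χ)‖ log D > ε` for every
primitive quadratic `χ` of conductor `D ≥ q₀` (an effective Hecke-type bound at large conductors,
which is not known). [cite: FriedlanderIwaniec2019TwinPrimes, Corollary 1.1] -/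
theorem eta_bounded_below_of_not_twinPrime (hFI : FriedlanderIwaniec2019_theorem1)
    (hno : ¬ TwinPrimeConjecture) :
    ∃ ε : ℝ, 0 < ε ∧ ∃ q₀ : ℕ, ∀ (D : ℕ) [NeZero D] (χ : DirichletCharacter ℂ D),
      q₀ ≤ D → 3 ≤ D → χ.IsPrimitive → χ.IsQuadratic → ε < ‖χ.LFunction 1‖ * Real.log D := by
  by_contra hne
  apply hno
  refine twinPrimeConjecture_of_smallEtaCharacters hFI fun ε hε q₀ => ?_
  by_contra hex
  apply hne
  refine ⟨ε, hε, q₀, fun D _ χ hq₀ hD3 hprim hquad => ?_⟩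
  by_contra hle
  rw [not_lt] at hle
  exact hex ⟨D, inferInstance, χ, hq₀, hD3, hprim, hquad, hle⟩


/-! ### Appended 2026-08-26: the absolute threshold form of Corollary 1.1

"If `η(D)` is small we call the character `χ` exceptional" — the proof of
`twinPrimeConjecture_of_smallEtaCharacters` uses the hypothesis at ONE value
`ε₀ = C₂/(4·3500·K)` only (`K` = the implied constant of Theorem 1 for `h = 2`), so Theorem 1 yields
the stronger, threshold form of Corollary 1.1: an ABSOLUTE `ε₀ > 0` such that infinitely many
primitive real characters with `η(D) ≤ ε₀` already give infinitely many twin primes. This is the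
faithful reading of the printed corollary (a fixed notion of "small"), and it implies the `∀ ε`
form. -/

/-- **Corollary 1.1, threshold form** (from Theorem 1): there is an absolute `ε₀ > 0` (depending
only on the implied constant of Theorem 1 at `h = 2`) such that `SmallEtaCharacters ε₀` — primitive
real characters with `η(D) = L(1,χ) log D ≤ ε₀` at arbitrarily large conductors — implies the twin
prime conjecture. [cite: FriedlanderIwaniec2019TwinPrimes, Theorem 1, (1.6)–(1.7) and Corollary 1.1] -/
theorem exists_eta_threshold_twinPrimeConjecture (hFI : FriedlanderIwaniec2019_theorem1) :
    ∃ ε : ℝ, 0 < ε ∧ (SmallEtaCharacters ε → TwinPrimeConjecture) := by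
  obtain ⟨K, hK, hT⟩ := hFI 2 (by norm_num) (by decide)
  have hC₂ : 0 < twinPrimeConst := twinPrimeConst_pos_holds
  -- the absolute threshold `ε₀ = C₂/(4·3500·K)`, `K` the implied constant of Theorem 1 at `h = 2`
  set ε : ℝ := twinPrimeConst / (4 * 3500 * K) with hε
  have hεpos : 0 < ε := by positivity
  refine ⟨ε, hεpos, fun hexc => ?_⟩
  by_contra hno
  obtain ⟨X₁, hX₁⟩ := eventually_atTop.mp (robustHLFailure_of_not_twinPrime hno)
  set L : ℝ := 4 * K / (3500 * twinPrimeConst) with hL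
  have hLpos : 0 < L := by positivity
  obtain ⟨D, hDne, χ, hDq, hD3, hprim, hquad, hη⟩ :=
    hexc (max (⌈X₁⌉₊) (⌈Real.exp L⌉₊))
  have hDX₁ : ⌈X₁⌉₊ ≤ D := le_trans (le_max_left _ _) hDq
  have hDL : ⌈Real.exp L⌉₊ ≤ D := le_trans (le_max_right _ _) hDq
  have hD3r : (3 : ℝ) ≤ D := by exact_mod_cast hD3
  have hDpos : (0 : ℝ) < D := by linarith
  have hD1 : (1 : ℝ) ≤ D := by linarith
  have hlog1 : 1 ≤ Real.log D := one_le_log_of_three_le hD3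
  have hlogpos : 0 < Real.log D := by linarith
  have hlogL : L ≤ Real.log D := by
    have h1 : Real.exp L ≤ D := le_trans (Nat.le_ceil _) (by exact_mod_cast hDL)
    calc L = Real.log (Real.exp L) := (Real.log_exp L).symm
      _ ≤ Real.log D := Real.log_le_log (Real.exp_pos L) h1
  -- the scale `X = D^{3500}`
  set X : ℝ := (D : ℝ) ^ (3500 : ℕ) with hX
  have hXpos : 0 < X := by positivity
  have hXD : (D : ℝ) ≤ X := by
    calc (D : ℝ) = (D : ℝ) ^ 1 := (pow_one _).symm
      _ ≤ X := pow_le_pow_right₀ hD1 (by norm_num)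
  have hX₁X : X₁ ≤ X := le_trans (le_trans (Nat.le_ceil X₁) (by exact_mod_cast hDX₁)) hXD
  have hlogX : Real.log X = 3500 * Real.log D := by
    rw [hX, Real.log_pow]; norm_num
  -- Theorem 1 at `X`
  have h1 := hT D hD3 χ hprim hquad X le_rfl
  -- the failure at `X`
  have h2 := hX₁ X hX₁X
  -- the error is `< C₂ X`
  have herr : K * (‖χ.LFunction 1‖ * X * Real.log X + X / Real.log X) < twinPrimeConst * X := by
    rw [hlogX]
    have ha : K * (‖χ.LFunction 1‖ * X * (3500 * Real.log D)) ≤ twinPrimeConst / 4 * X := by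
      have : K * (‖χ.LFunction 1‖ * X * (3500 * Real.log D)) =
          (3500 * K) * (‖χ.LFunction 1‖ * Real.log D) * X := by ring
      rw [this]
      have hb : (3500 * K) * (‖χ.LFunction 1‖ * Real.log D) ≤ (3500 * K) * ε :=
        mul_le_mul_of_nonneg_left hη (by positivity)
      have hc : (3500 * K) * ε = twinPrimeConst / 4 := by
        rw [hε]; field_simp
      nlinarith
    have hb : K * (X / (3500 * Real.log D)) ≤ twinPrimeConst / 4 * X := by
      have h3 : K / (3500 * Real.log D) ≤ twinPrimeConst / 4 := by
        rw [div_le_div_iff₀ (by positivity) (by norm_num)]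
        have : 4 * K ≤ L * (3500 * twinPrimeConst) := by
          rw [hL]; field_simp; exact le_rfl
        nlinarith
      have : K * (X / (3500 * Real.log D)) = K / (3500 * Real.log D) * X := by ring
      rw [this]
      exact mul_le_mul_of_nonneg_right h3 hXpos.le
    have hsplit : K * (‖χ.LFunction 1‖ * X * (3500 * Real.log D) + X / (3500 * Real.log D)) =
        K * (‖χ.LFunction 1‖ * X * (3500 * Real.log D)) + K * (X / (3500 * Real.log D)) := by
      ring
    rw [hsplit]
    nlinarith
  linarith


/-- The `∀ ε` form follows from the threshold form. [cite: FriedlanderIwaniec2019TwinPrimes, Corollary 1.1] -/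
theorem twinPrimeConjecture_of_smallEtaCharacters' (hFI : FriedlanderIwaniec2019_theorem1)
    (hexc : ∀ ε : ℝ, 0 < ε → SmallEtaCharacters ε) : TwinPrimeConjecture := by
  obtain ⟨ε, hε, h⟩ := exists_eta_threshold_twinPrimeConjecture hFI
  exact h (hexc ε hε)

end Literature.NumberTheory.LFunctions

end
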